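import Summits.Ventures.PercRepro.C025ProfilePLDBridge
import Summits.Ventures.PercRepro.C025ProfileTwoFlatC025

/-!
# ROWS OF A MATROID GIVE C-025 ON EVERY TRUNCATION; (PLD)(M) GIVES C-025 ON «M PLUS FREE POINTS» (night-3 g27)

`proofs/NIGHT3-G27-PLD.md` §3.  Truncating a finite matroid to rank `r` keeps the rank-`q` members and the level `u`
for `q, u < r` (`Rq_truncate`, `levelSet_truncate`) and lowers every price (`price_truncate_le`, the price is monotone
in the corank, `PriceMono.choose_div_choose_mono`), so a row `(q, u)` of (Π) with `u < r` passes to the truncation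
(`profileIneq_truncate`).  With `GirthRows.rls_of_profileIneq_rows` and `ThmN.RLS_of_eRank_lt`: the rows `(q, u)`,
`q < u < r`, of ANY finite matroid `M` give C-025 on `Matroid.truncate M r` at every `(p, q)` (`rls_truncate_of_profileIneq_rows`),
and, with `profileIneq_disjointSum_freeOn_of_pld`, PER-LAYER DOMINANCE of `M` gives C-025 at every `(p, q)` on every
truncation of `M ⊕ freeOn E₃`, every finite `E₃` (`rls_disjointSum_freeOn_of_pld`).
No `def`, no `instance`, no notation.  Axioms: standard.
-/

open scoped Matroid

namespace PercRepro

open Finset ThmH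

namespace PLDBridge

variable {α : Type} [DecidableEq α]

omit [DecidableEq α] in
/-- The ground finset of a truncation. -/
theorem gr_truncate (M : Matroid α) [M.Finite] (r : ℕ) : gr (Matroid.truncate M r) = gr M := by
  apply Finset.coe_injective
  rw [coe_gr, coe_gr, Matroid.truncate_ground]

omit [DecidableEq α] in
/-- The rank-`q` members of a truncation to rank `r > q` are those of the matroid. -/
theorem Rq_truncate (M : Matroid α) [M.Finite] {q r : ℕ} (hqr : q < r) :
    Profile.Rq (Matroid.truncate M r) q = Profile.Rq M q := by
  ext B
  rw [Profile.mem_Rq, Profile.mem_Rq, gr_truncate, Matroid.truncate_eRk]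
  constructor
  · rintro ⟨hB, hmin⟩
    refine ⟨hB, ?_⟩
    rcases min_eq_iff.1 hmin with ⟨h1, -⟩ | ⟨h1, -⟩
    · exact h1
    · exact absurd (by exact_mod_cast h1 : r = q) (by omega)
  · rintro ⟨hB, hq⟩
    exact ⟨hB, by rw [hq]; exact min_eq_left (by exact_mod_cast hqr.le)⟩

omit [DecidableEq α] in
/-- The level `u` of a truncation to rank `r > u` is the level `u` of the matroid. -/
theorem levelSet_truncate (M : Matroid α) [M.Finite] {u r : ℕ} (hur : u < r) :
    Shadow.levelSet (Matroid.truncate M r) u = Shadow.levelSet M u := by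
  ext S
  rw [Profile.mem_levelSet, Profile.mem_levelSet, gr_truncate, Matroid.truncate_eRk]
  constructor
  · rintro ⟨hS, hmin⟩
    refine ⟨hS, ?_⟩
    rcases min_eq_iff.1 hmin with ⟨h1, -⟩ | ⟨h1, -⟩
    · exact h1
    · exact absurd (by exact_mod_cast h1 : r = u) (by omega)
  · rintro ⟨hS, hu⟩
    exact ⟨hS, by rw [hu]; exact min_eq_left (by exact_mod_cast hur.le)⟩

/-- Truncation lowers every price: the corank can only drop and the price is monotone in it. -/
theorem price_truncate_le (M : Matroid α) [M.Finite] {q u : ℕ} (hqu : q ≤ u) (r : ℕ) (B : Finset α) :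
    Profile.price (Matroid.truncate M r) q u B ≤ Profile.price M q u B := by
  have hfin : M.eRk ((gr M \ B : Finset α) : Set α) ≠ ⊤ := by
    have := M.eRk_le_eRank ((gr M \ B : Finset α) : Set α)
    exact ne_top_of_le_ne_top (M.eRank_ne_top_iff.2 inferInstance) this
  obtain ⟨p, hp⟩ : ∃ p : ℕ, M.eRk ((gr M \ B : Finset α) : Set α) = (p : ℕ∞) := ⟨_, (ENat.coe_toNat hfin).symm⟩
  have hmin : min (p : ℕ∞) (r : ℕ∞) = ((min p r : ℕ) : ℕ∞) := by
    rcases le_total p r with h | h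
    · rw [min_eq_left (by exact_mod_cast h), min_eq_left h]
    · rw [min_eq_right (by exact_mod_cast h), min_eq_right h]
  unfold Profile.price
  rw [gr_truncate, Matroid.truncate_eRk, hp, hmin, ENat.toNat_coe, ENat.toNat_coe]
  by_cases hu : (u : ℕ∞) ≤ ((min p r : ℕ) : ℕ∞)
  · have hu' : u ≤ min p r := by exact_mod_cast hu
    rw [if_pos hu, if_pos (by exact_mod_cast (le_trans hu' (min_le_left p r)))]
    exact PriceMono.choose_div_choose_mono hqu hu' (min_le_left p r)
  · rw [if_neg hu]
    split_ifs
    · positivity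
    · exact le_rfl

/-- A row `(q, u)` of (Π), `q < u < r`, passes to the truncation at rank `r`. -/
theorem profileIneq_truncate (M : Matroid α) [M.Finite] {q u r : ℕ} (hqu : q < u) (hur : u < r)
    (h : Profile.ProfileIneq M q u) : Profile.ProfileIneq (Matroid.truncate M r) q u := by
  unfold Profile.ProfileIneq at h ⊢
  rw [Rq_truncate M (lt_trans hqu hur), levelSet_truncate M hur]
  exact le_trans (sum_le_sum fun B _ => price_truncate_le M hqu.le r B) h

omit [DecidableEq α] in
/-- The rank of a truncation is at most the truncation level. -/
theorem eRank_truncate_le (M : Matroid α) [M.Finite] (r : ℕ) : (Matroid.truncate M r).eRank ≤ (r : ℕ∞) := by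
  rw [Matroid.eRank_def, Matroid.truncate_ground, Matroid.truncate_eRk]
  exact min_le_right _ _

/-- **THE ROWS OF A MATROID GIVE C-025 ON EVERY TRUNCATION**: if `M` satisfies the rows `(q, u)` of (Π) for
`q < u < r`, then `Matroid.truncate M r` satisfies C-025 at every `(p, q)`. -/
theorem rls_truncate_of_profileIneq_rows (M : Matroid α) [M.Finite] (r p q : ℕ)
    (h : ∀ u, q < u → u < r → Profile.ProfileIneq M q u) : ThmN.RLS (Matroid.truncate M r) p q := by
  by_cases hpr : p ≤ r
  · exact GirthRows.rls_of_profileIneq_rows p q fun u hu1 hu2 =>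
      profileIneq_truncate M hu1 (lt_of_lt_of_le hu2 hpr) (h u hu1 (lt_of_lt_of_le hu2 hpr))
  · exact ThmN.RLS_of_eRank_lt _ (lt_of_le_of_lt (eRank_truncate_le M r) (by exact_mod_cast (not_le.1 hpr : r < p)))

/-- **PER-LAYER DOMINANCE OF `M` GIVES C-025 AT EVERY `(p, q)` ON EVERY TRUNCATION OF «`M` PLUS FREE POINTS»**
(any finite matroid `M`, any finite `E₃` disjoint from `E_M`, any truncation level `r`). -/
theorem rls_disjointSum_freeOn_of_pld (M : Matroid α) [M.Finite] (E₃ : Finset α)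
    (h : Disjoint M.E (E₃ : Set α)) (r p q : ℕ)
    (hPLD : ∀ lo hi δ Θ : ℕ, Θ ≤ lo + hi + δ → (lo = 0 ∨ lo + hi + δ ≤ Θ) →
      (∑ I ∈ (gr M).powerset, (if lo ≤ (M.eRk (I : Set α)).toNat ∧ (M.eRk (I : Set α)).toNat ≤ hi ∧
          Θ ≤ (M.eRk ((gr M \ I : Finset α) : Set α)).toNat + (M.eRk (I : Set α)).toNat then
          ((M.eRk ((gr M \ I : Finset α) : Set α)).toNat).choose δ else 0)) ≤
        ∑ I ∈ (gr M).powerset, (if lo + δ ≤ (M.eRk ((gr M \ I : Finset α) : Set α)).toNat ∧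
          (M.eRk ((gr M \ I : Finset α) : Set α)).toNat ≤ hi + δ then
          ((M.eRk ((gr M \ I : Finset α) : Set α)).toNat).choose δ else 0)) :
    haveI := disjointSum_freeOn_finite M E₃ h
    ThmN.RLS (Matroid.truncate (M.disjointSum (Matroid.freeOn (E₃ : Set α)) h) r) p q := by
  haveI := disjointSum_freeOn_finite M E₃ h
  exact rls_truncate_of_profileIneq_rows _ r p q fun u hu _ =>
    profileIneq_disjointSum_freeOn_of_pld M E₃ h hu hPLD

end PLDBridge

end PercRepro
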